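import Literature.Computability.FineGrained.OVPolyDimProgram
import Literature.Computability.FineGrained.CliqueETHGroupingReduction
import Literature.Computability.FineGrained.SETHHardnessProofs
import Literature.Computability.FineGrained.EditDistanceSETH
import HarnessLib

/-!
# SETH ⇒ OVH: Williams' split-and-list reduction on the word RAM, polynomial dimension (proof of
# the named fact `kSATInRAMTime_of_ovInTimePolyDim`)

The proof of the named fact `kSATInRAMTime_of_ovInTimePolyDim` of `…FineGrained.EditDistanceSETH`
(R. Williams, *A new algorithm for optimal 2-constraint satisfaction and its implications*,
TCS 348 (2005), §5.1, Thm. 5.1; K. Bringmann, M. Künnemann, FOCS 2015, Lemma 2.1 "SETH implies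
OVH"): if for some `0 < ε ≤ 1` Orthogonal Vectors is decided on the deterministic word RAM within
`⌊C ((n+1)^{2-ε} (d+1)^c)⌋₊` steps (`OVInTimePolyDim ε`), then for every width `k` and every
`δ > 1 - ε/2`, `k`-SAT (`kSATProblem k`: width `≤ k`, no repeated clause) is decided on the word RAM
in time `O(2^{δ n})` (`KSATInRAMTime k δ`). The program is the split-and-list reduction of
`…OVPolyDimProgram` (the build of `…OVFromSETHReductionProgram` with dimension `d = m`, presenting
the unpadded instance `SplitList.splitOV φ`); this file supplies, verbatim along
`…OVFromSETHProofs`,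

* **the run** (`Params.reduction_outputsWithin`): `envOK`, `tinv_finMem`, `agree_finMem`,
  `post_spec`, and by `SProg.outputsWithin_withSubrun` the reduction program outputs the OV
  program's answer bit — `[1]` iff `φ` is satisfiable, by `SplitList.hasOrthogonalPair_splitOV_iff` —
  within `Tpre + 38 T + 4` steps;
* **the word size** (`Params.kfit`, `Params.fits`): at `W = kfit · (n + inputWidth x)` everything
  fits — here `d = m ≤ |x| < 2^{width}`, so `N d < 2^{n + width}`;
* **the time**: the build costs `O_k(N · (|x| + n))` with `|x| ≤ (k+3) (2(n+1))^{k+3}`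
  (`kSAT_size_bounds`: no repeated clauses) and `N = 2^{⌈n/2⌉} ≤ 2 · 2^{n/2}`, the emulated run
  costs `38 ⌊C (N+1)^{2-ε} (m+1)^c⌋ = O(2^{(1-ε/2) n} poly(n))`; both are `O(2^{δ n})` for
  `δ > 1 - ε/2 ≥ 1/2` — **no sparsification is needed**;
* **the named fact** `kSATInRAMTime_of_ovInTimePolyDim_holds`, and with it the discharge
  `ovhWordRAM_of_sethWordRAM_holds` (BK15, Lemma 2.1).

## References

* R. Williams, *A new algorithm for optimal 2-constraint satisfaction and its implications*,
  Theoret. Comput. Sci. 348 (2005) 357–365, §5.1 (Thm. 5.1; Theorem 5 of the author's version).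
* K. Bringmann, M. Künnemann, *Quadratic conditional lower bounds for string problems and dynamic
  time warping*, FOCS 2015, §2.1, Lemma 2.1.
* V. Vassilevska Williams, *On some fine-grained questions in algorithms and complexity*,
  Proc. ICM 2018, §2 (word RAM), §3.
-/

namespace Literature.Computability.FineGrained

open Cryptography Cryptography.WordRAM Complexity Cryptography.WordRAM.SProg

namespace OVPoly

open CliqueRed (r pt im lay)
open SplitList (half half_le le_two_mul_half)

namespace Params

variable (g : Params) {W : ℕ} {O : List ℕ → List ℕ}

/-! ### The run -/

/-- The emulator's side conditions hold for the reduction's layout and environment. [folklore] -/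
theorem envOK (hF : g.Fits W) : EnvOK lay g.env W := by
  obtain ⟨hX, hXLx, hBv, hSv, htop, -⟩ := g.facts hF
  refine ⟨by decide, by decide, by decide, by decide, by decide, by decide, by decide,
    fun r hr => ?_, Or.inl ?_, ?_, ?_, hF.ws_lt.le⟩
  · simp only [lay, Layout.regs, List.mem_cons, List.not_mem_nil, or_false] at hr
    show r < g.Bv ∧ r < g.Sv
    rcases hr with rfl | rfl | rfl | rfl | rfl | rfl | rfl <;> omega
  · show g.Bv + (g.V + 1) ≤ g.Sv; omega
  · show g.Bv + (g.V + 1) ≤ 2 ^ W; omega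
  · show g.Sv + (g.V + 1) ≤ 2 ^ W; omega

/-- Every cell of the final memory is below `2 ^ W`. [folklore] -/
theorem finMem_lt (hF : g.Fits W) (a : ℕ) : g.finMem a < 2 ^ W := by
  obtain ⟨hX, hXLx, hBv, hSv, htop, hNdV, hPwV, -⟩ := g.facts hF
  unfold finMem
  by_cases ha : a < 100
  · rw [if_pos ha]; split_ifs <;> omega
  rw [if_neg ha]
  unfold finData
  split_ifs
  · exact lt_of_le_of_lt (CliqueRed.relocated_le_of_forall (B := 2 ^ W - 1)
      (fun v hv => Nat.le_sub_one_of_lt (hF.input v hv)) (by omega)) (by omega)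
  · have := g.ycell_lt_Pw (a - g.Bv); omega

/-- The emulated cells are the initial memory of the OV program on `y` at word size `ws`.
[folklore] -/
theorem ycell_eq_init (j : ℕ) : g.ycell j = (init g.ws g.y).mem j := by
  have hlen : g.y.length = 2 * g.Nd + 2 := by
    unfold y Nd; rw [length_OV_encode, ← g.N_eq, ← g.d_eq]; ring
  unfold ycell
  rcases Nat.eq_zero_or_pos j with rfl | hj
  · rw [if_pos rfl, init_mem_zero, hlen]; rfl
  · obtain ⟨i, rfl⟩ := Nat.exists_eq_add_of_le' hj
    rw [if_neg (by omega), Nat.add_sub_cancel]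
    by_cases hi : i < g.y.length
    · rw [init_mem_succ _ _ _ hi, List.getD_eq_getElem _ _ hi]; rfl
    · rw [init_mem_of_length_lt _ _ _ (by omega), List.getD_eq_default _ _ (by omega)]; simp

/-- The stamps of the final memory are `0`. [folklore] -/
theorem finMem_stamp (hF : g.Fits W) (a : ℕ) : g.finMem (g.Sv + a) = 0 := by
  obtain ⟨hX, hXLx, hBv, hSv, htop, hNdV, -⟩ := g.facts hF
  unfold finMem finData
  rw [if_neg (by omega), if_neg (by omega)]
  exact g.ycell_of_le (by omega)

/-- **The target invariant at the end of the build.** [folklore] -/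
theorem tinv_finMem (hF : g.Fits W) : TInv lay g.env (2 ^ W - 1) g.finMem := by
  refine ⟨⟨?_, ?_, ?_, ?_⟩, fun a _ => ?_, fun a => Nat.le_sub_one_of_lt (g.finMem_lt hF a)⟩
  · show g.finMem 10 = g.Bv; simp [finMem]
  · show g.finMem 11 = g.Sv; simp [finMem]
  · show g.finMem 12 = 0; simp [finMem]
  · show g.finMem 13 = 2 ^ g.ws; simp [finMem]; rfl
  · show g.finMem (g.Sv + a) ≤ 0
    rw [g.finMem_stamp hF a]

/-- **The emulated input is in place at the end of the build**: the emulated memory is the initial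
memory of the OV program on `y` at word size `ws`. [folklore] -/
theorem agree_finMem (hF : g.Fits W) : Agree g.env g.finMem (init g.ws g.y).mem := by
  obtain ⟨hX, hXLx, hBv, hSv, -⟩ := g.facts hF
  intro a _
  show (if g.finMem (g.Sv + a) = 0 then g.finMem (g.Bv + a) else 0) = (init g.ws g.y).mem a
  rw [if_pos (g.finMem_stamp hF a), ← g.ycell_eq_init]
  unfold finMem finData
  rw [if_neg (by omega), if_neg (by omega), Nat.add_sub_cancel_left]

/-- **The read-out.** From any memory agreeing with the halting memory `dm` of the OV program
(target invariant kept), `post` outputs `[dm 1]` in `3` steps. [folklore] -/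
theorem post_spec (hF : g.Fits W) {m₂ dm : ℕ → ℕ} (hag : Agree g.env m₂ dm)
    (hI : TInv lay g.env (2 ^ W - 1) m₂) (qs : List (List ℕ)) :
    ∃ (st₃ : Store) (t₃ : ℕ), t₃ ≤ 3 ∧ Exec W O CliqueRed.post ⟨m₂, qs⟩ st₃ t₃ ∧
      readOut st₃.mem = [dm 1] := by
  obtain ⟨hX, hXLx, hBv, hSv, htop, hNdV, -⟩ := g.facts hF
  have h10 : m₂ 10 = g.Bv := hI.env.1
  have hst : m₂ (g.Sv + 1) = 0 := Nat.le_zero.1 (hI.stamp 1 (by show 1 < g.V + 1; omega))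
  have h1 : m₂ (g.Bv + 1) = dm 1 := by
    have := hag 1 (by show 1 < g.V + 1; omega)
    simp only [edec, Params.env, hst, if_true] at this
    exact this
  refine ⟨_, 3, le_rfl, Exec.block _ m₂ qs, ?_⟩
  have hm : execOps W m₂ [(.add, r 17, r 10, im 1), (.band, r 1, pt 17, pt 17), (.band, r 0, im 1,
    im 1)] =
      Function.update (Function.update (Function.update m₂ 17 (g.Bv + 1)) 1 (dm 1)) 0 1 := by
    simp (disch := first | omega | decide) only [execOps_cons, execOps_nil, execOp, Operand.write,
      Operand.read, Function.update_self, Function.update_of_ne, h10, BinOp.eval_add_of_lt,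
      BinOp.eval_band, Nat.and_self]
    rw [h1]
  show readOut (execOps W m₂ _) = _
  rw [hm]
  simp [readOut, readSeg, Function.update_self, Function.update_of_ne]

/-- The total time of the reduction program, given a time bound `T` for the OV program.
[folklore] -/
def Ttotal (k T : ℕ) : ℕ := g.Tpre k + cstep * T + 4

/-- **The reduction program's output.** At a word size `W` with `g.Fits W` (width `≤ k`), if the
deterministic oracle-free OV program `M` (largest constant `cM`) outputs `[bit]` on the split
instance `y` at word size `ws = kM · width` within `T` steps, then the reduction program outputs
`[bit]` on `x = encodeCNFWords φ` within `Tpre + 38 T + 4` steps. [folklore] -/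
theorem reduction_outputsWithin (hF : g.Fits W) {k : ℕ} (hw : g.φ.IsWidthLE k)
    {M : Program} (hdet : M.IsDeterministic) (hof : M.IsOracleFree) (hcM : M.maxConst = g.cM)
    {T bit : ℕ} (hM : OutputsWithin M g.ws noOracle zeroCoins g.y [bit] T) :
    OutputsWithin (withSubrun (pre g.kM g.cM) lay M CliqueRed.post) W noOracle zeroCoins g.x
      [bit] (g.Ttotal k T) := by
  obtain ⟨hX, hXLx, hBv, hSv, htop, hNdV, hPwV, hcMV, -⟩ := g.facts hF
  have hW1 : 1 ≤ W := by have := hF.ws_lt; omega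
  have h2W : 2 ≤ 2 ^ W := by
    calc (2 : ℕ) = 2 ^ 1 := rfl
      _ ≤ 2 ^ W := Nat.pow_le_pow_right (by norm_num) hW1
  obtain ⟨st₁, t₁, ht₁, hexec, hmem, hqs⟩ := (g.pre_spec (O := noOracle) hF hw).exists_exec
  obtain ⟨dh, hhalt, hout⟩ := (outputsWithin_iff_exists_haltsWithin _ _ _ _ _ _ _).1 hM
  have hst₁ : st₁ = ⟨g.finMem, []⟩ := by cases st₁; simp only at hmem hqs; rw [hmem, hqs]
  subst hst₁
  have key := outputsWithin_withSubrun (O := noOracle) zeroCoins (pre := pre g.kM g.cM)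
    (post := CliqueRed.post) (L := lay) (E := g.env) (VT := 2 ^ W - 1) (V := g.V) (M := M)
    (x := g.x) (y := g.y) (out := [bit]) (T₂ := 3) hF.width hexec (g.envOK hF) (by omega)
    (by omega)
    (fun r hr => by
      simp only [lay, Layout.regs, List.mem_cons, List.not_mem_nil, or_false] at hr
      rcases hr with rfl | rfl | rfl | rfl | rfl | rfl | rfl <;> omega)
    hdet hof (by rw [hcM]; exact hcMV) (by show g.V < g.V + 1; omega) (by omega)
    (by show 2 ^ g.ws - 1 ≤ g.V; have := g.le_V; unfold Pw at this; omega) (by omega)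
    (g.tinv_finMem hF) (g.agree_finMem hF) hhalt
    (fun m₂ hag hI _ => by
      have := g.post_spec (O := noOracle) hF hag hI []
      rwa [CliqueRed.mem_one_of_readOut hout] at this)
  exact key.mono (by unfold Ttotal; omega)

/-! ### The size of the build -/

/-- `Lx = 2 + m + size ≤ 2 + (k + 1) m` for width `≤ k`. [folklore] -/
theorem Lx_le {k : ℕ} (hw : g.φ.IsWidthLE k) : g.Lx ≤ 2 + (k + 1) * g.m := by
  have := OVRed.size_le_mul_of_isWidthLE hw
  unfold Lx x m at *
  rw [length_encodeCNFWords_eq, CNF.numClauses]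
  nlinarith

/-- **The running time of the build**: `O_k(N · (Lx + n + 1))`. [folklore] -/
theorem Tpre_le (k : ℕ) : g.Tpre k ≤ (34 * k + 218) * (g.N * (g.Lx + g.n + 1)) := by
  have hN : 1 ≤ g.N := g.one_le_N
  have hLx : 2 ≤ g.Lx := g.two_le_Lx
  have hm : g.m ≤ g.Lx := by have := g.m_add_two_le_Lx; omega
  have hσ : Nat.size (2 * g.Nd + 2) ≤ 2 * g.Nd + 2 := CliqueRed.size_le_self _
  have hdLx : g.d ≤ g.Lx := by have := g.m_add_two_le_Lx; show g.m + 1 ≤ g.Lx; omega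
  have hNd : g.Nd ≤ g.N * g.Lx := Nat.mul_le_mul_left _ hdLx
  set P := g.N * (g.Lx + g.n + 1) with hP
  have hP1 : g.Lx + g.n + 1 ≤ P := Nat.le_mul_of_pos_left _ hN
  have hPN : g.N ≤ P := Nat.le_mul_of_pos_right _ (by omega)
  have hNLx : g.N * g.Lx ≤ P := Nat.mul_le_mul_left _ (by omega)
  unfold Tpre Trows Trow Trp Tcl
  -- the rows
  have hrows : g.N * (g.m * (17 * k + 10 + 2) + 4 + 8 + 2) + 3 ≤ (17 * k + 12) * P + 17 * P := by
    have h1 : g.m * (17 * k + 10 + 2) ≤ (17 * k + 12) * g.Lx := by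
      rw [Nat.mul_comm]; exact Nat.mul_le_mul_left _ hm
    calc g.N * (g.m * (17 * k + 10 + 2) + 4 + 8 + 2) + 3
        ≤ g.N * ((17 * k + 12) * g.Lx + 14) + 3 := by
          have := Nat.mul_le_mul_left g.N (show g.m * (17 * k + 10 + 2) + 4 + 8 + 2 ≤
            (17 * k + 12) * g.Lx + 14 by omega); omega
      _ = (17 * k + 12) * (g.N * g.Lx) + 14 * g.N + 3 := by ring
      _ ≤ (17 * k + 12) * P + 14 * P + 3 * P := by
          have := Nat.mul_le_mul_left (17 * k + 12) hNLx; nlinarith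
      _ = (17 * k + 12) * P + 17 * P := by ring
  have hsize : Nat.size (2 * g.Nd + 2) * 4 + 1 ≤ 8 * P + 9 * P := by
    calc Nat.size (2 * g.Nd + 2) * 4 + 1 ≤ (2 * g.Nd + 2) * 4 + 1 := by omega
      _ ≤ (2 * (g.N * g.Lx) + 2) * 4 + 1 := by omega
      _ = 8 * (g.N * g.Lx) + 9 := by ring
      _ ≤ 8 * P + 9 * P := by nlinarith
  have hLx' : 7 * g.Lx ≤ 7 * P := by nlinarith
  have hconst : 14 + 16 + 10 + 96 ≤ 136 * P := by nlinarith
  calc 7 * g.Lx + 14 + (Nat.size (2 * g.Nd + 2) * 4 + 1) + 16 + 10 +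
        (g.N * (g.m * (17 * k + 10 + 2) + 4 + 8 + 2) + 3) +
        (g.N * (g.m * (17 * k + 10 + 2) + 4 + 8 + 2) + 3) + 96
      ≤ 7 * P + (8 * P + 9 * P) + 2 * ((17 * k + 12) * P + 17 * P) + 136 * P := by omega
    _ = (34 * k + 218) * P := by ring

/-! ### The word-size constant -/

/-- **The word-size constant** of the reduction: with `W = kfit · (n + inputWidth x)` every
address and value of the run fits (`fits`). [folklore] -/
def kfit (kM cM : ℕ) : ℕ := 3 * kM + Nat.size (2 * cM + 109) + 5

/-- **The word size fits.** The run at word size `kfit · (n + inputWidth x)` satisfies `Fits`: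
`m + 1 ≤ |x| < 2^w` and `N = 2^h ≤ 2^n`, so `N d < 2^{n + w}` and everything is
`O(2^{kM (n + w + 2) + n + w})`. [folklore] -/
theorem fits : g.Fits (kfit g.kM g.cM * (g.n + inputWidth g.x)) := by
  -- notation
  set n := g.n with hn
  set w := inputWidth g.x with hw
  set A := 2 * g.cM + 109 with hA
  set sA := Nat.size A with hsA
  have hw1 : 1 ≤ w := inputWidth_pos _
  have hLx : g.Lx < 2 ^ w := length_lt_two_pow_inputWidth _
  obtain ⟨hX, hBv, hSv⟩ := g.bases
  have hmLx := g.m_add_two_le_Lx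
  have hd : g.d = g.m + 1 := rfl
  have hhn : g.h ≤ n := half_le _
  have hN : g.N ≤ 2 ^ n := Nat.pow_le_pow_right Nat.two_pos hhn
  -- `N d < 2^(n + w)`
  have hNd : g.Nd + 1 ≤ 2 ^ (n + w) := by
    have h1 : g.Nd ≤ 2 ^ n * g.d := Nat.mul_le_mul_right _ hN
    have h2 : g.d < 2 ^ w := by omega
    have h3 : 2 ^ n * g.d + 2 ^ n ≤ 2 ^ n * 2 ^ w := by
      rw [← Nat.mul_succ]; exact Nat.mul_le_mul_left _ h2
    rw [Nat.pow_add]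
    have : 1 ≤ 2 ^ n := Nat.one_le_two_pow
    omega
  -- the exponent
  set E := g.kM * (n + w + 2) + (n + w + 2) with hE
  have h2E : ∀ t, t ≤ E → 2 ^ t ≤ 2 ^ E := fun t ht => Nat.pow_le_pow_right Nat.two_pos ht
  have hσ : Nat.size (2 * g.Nd + 2) ≤ n + w + 2 := by
    refine Nat.size_le.2 ?_
    calc 2 * g.Nd + 2 = 2 * (g.Nd + 1) := by ring
      _ ≤ 2 * 2 ^ (n + w) := Nat.mul_le_mul_left _ hNd
      _ = 2 ^ (n + w + 1) := by rw [Nat.pow_succ]; ring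
      _ < 2 ^ (n + w + 2) := Nat.pow_lt_pow_right (by norm_num) (by omega)
  have hws : g.ws ≤ g.kM * (n + w + 2) := Nat.mul_le_mul_left _ hσ
  have hPw : g.Pw ≤ 2 ^ E := h2E _ (by omega)
  have h2Nd : 2 * g.Nd + 2 ≤ 2 ^ E :=
    le_trans (Nat.lt_size_self _).le (h2E _ (hσ.trans (by omega)))
  have hLxE : g.Lx ≤ 2 ^ E := hLx.le.trans (h2E _ (by omega))
  have hV : g.V ≤ 2 ^ E + g.cM + 2 ^ E := by
    unfold V
    refine max_le (by omega) (max_le (by omega) (by omega))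
  -- the top of the stamp region
  have htop : g.Sv + g.V + 1 ≤ A * 2 ^ E := by
    have e : g.Sv + g.V + 1 = 2 * g.Lx + 2 * g.V + 103 := by
      rw [← hSv, ← hBv]; unfold X; ring
    rw [e]
    have e1 : 2 * g.Lx ≤ 2 * 2 ^ E := by omega
    have e2 : 2 * g.V ≤ (4 + 2 * g.cM) * 2 ^ E := by
      have : 2 * g.cM ≤ 2 * g.cM * 2 ^ E := CliqueRed.le_self_mul_two_pow _ _
      nlinarith
    have e3 : 103 ≤ 103 * 2 ^ E := CliqueRed.le_self_mul_two_pow _ _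
    have hsum := CliqueRed.add_le_mul_two_pow (CliqueRed.add_le_mul_two_pow e1 e2) e3
    rw [show 2 + (4 + 2 * g.cM) + 103 = A by rw [hA]; ring] at hsum
    exact hsum
  have htot : g.Sv + g.V + 1 ≤ 2 ^ (sA + E) :=
    htop.trans (CliqueRed.mul_two_pow_le_two_pow_size_add A E)
  -- the word size
  have hkfit : kfit g.kM g.cM = 3 * g.kM + sA + 5 := rfl
  set W := kfit g.kM g.cM * (n + w) with hWdef
  have hW : sA + E + 1 ≤ W := by
    rw [hWdef, hkfit, hE, Nat.add_mul, Nat.add_mul]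
    have h1 : sA ≤ sA * (n + w) := Nat.le_mul_of_pos_right _ (by omega)
    have h2 : g.kM * (n + w + 2) ≤ 3 * g.kM * (n + w) := by
      rw [Nat.mul_assoc, Nat.mul_comm 3, Nat.mul_assoc]
      exact Nat.mul_le_mul_left _ (by omega)
    omega
  have hNN : g.N * g.N < 2 ^ W := by
    have h2h : 2 * g.h ≤ n + 1 := by show 2 * half g.n ≤ n + 1; unfold half; omega
    calc g.N * g.N = 2 ^ (2 * g.h) := by unfold N; rw [← Nat.pow_add]; ring_nf
      _ ≤ 2 ^ (n + 1) := Nat.pow_le_pow_right Nat.two_pos h2h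
      _ < 2 ^ W := Nat.pow_lt_pow_right (by norm_num) (by omega)
  exact ⟨htot.trans (Nat.pow_le_pow_right Nat.two_pos (by omega)), by omega, hNN, by omega,
    by show g.m ≤ g.m + 1; omega⟩

/-! ### Sizes of `k`-SAT instances without repeated clauses -/

/-- **The polynomial scale** `M₁ = (2(n+1))^{k+1}` of a `k`-CNF on `n` variables without repeated
clauses: `m ≤ M₁` (`numClauses_le_of_nodup`), hence `Lx + n + 1 ≤ (k + 4) M₁` and
`m + 2 ≤ 3 M₁`. [folklore] -/
theorem sizes_le {k : ℕ} (hw : g.φ.IsWidthLE k) (hnd : g.φ.Nodup) :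
    g.Lx + g.n + 1 ≤ (k + 4) * (2 * (g.n + 1)) ^ (k + 1) ∧ g.m + 2 ≤ 3 * (2 * (g.n + 1)) ^ (k + 1) := by
  have hm : g.m ≤ (2 * (g.n + 1)) ^ (k + 1) := numClauses_le_of_nodup hw hnd
  have hLx := g.Lx_le hw
  set M₁ := (2 * (g.n + 1)) ^ (k + 1) with hM₁
  have hM1 : g.n + 1 ≤ M₁ := by
    calc g.n + 1 ≤ 2 * (g.n + 1) := by omega
      _ = (2 * (g.n + 1)) ^ 1 := (pow_one _).symm
      _ ≤ M₁ := Nat.pow_le_pow_right (by omega) (by omega)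
  have h1 : (k + 1) * g.m ≤ (k + 1) * M₁ := Nat.mul_le_mul_left _ hm
  constructor
  · calc g.Lx + g.n + 1 ≤ 2 + (k + 1) * M₁ + M₁ := by omega
      _ ≤ (k + 4) * M₁ := by nlinarith
  · omega

/-! ### The time in real terms -/

/-- `N^{2-ε} ≤ 2 · 2^{(1-ε/2) n}` for `0 ≤ ε ≤ 2` (`N = 2^{⌈n/2⌉}`). [folklore] -/
theorem N_rpow_le {ε : ℝ} (hε0 : 0 ≤ ε) (hε : ε ≤ 2) :
    (g.N : ℝ) ^ (2 - ε) ≤ 2 * (2 : ℝ) ^ ((1 - ε / 2) * g.n) := by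
  have hh2 : 2 * g.h ≤ g.n + 1 := by show 2 * half g.n ≤ g.n + 1; unfold half; omega
  have hhR : (g.h : ℝ) ≤ ((g.n : ℝ) + 1) / 2 := by
    have : (2 : ℝ) * g.h ≤ g.n + 1 := by exact_mod_cast hh2
    linarith
  have hN : (g.N : ℝ) = (2 : ℝ) ^ (g.h : ℝ) := by
    unfold N; push_cast; rw [Real.rpow_natCast]
  have h2ε : 0 ≤ 2 - ε := by linarith
  rw [hN, ← Real.rpow_mul (by norm_num)]
  calc (2 : ℝ) ^ ((g.h : ℝ) * (2 - ε)) ≤ (2 : ℝ) ^ (((g.n : ℝ) + 1) / 2 * (2 - ε)) :=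
        Real.rpow_le_rpow_of_exponent_le one_le_two (mul_le_mul_of_nonneg_right hhR h2ε)
    _ = (2 : ℝ) ^ (1 - ε / 2) * (2 : ℝ) ^ ((1 - ε / 2) * g.n) := by
        rw [← Real.rpow_add (by norm_num)]; ring_nf
    _ ≤ 2 * (2 : ℝ) ^ ((1 - ε / 2) * g.n) := by
        gcongr
        calc (2 : ℝ) ^ (1 - ε / 2) ≤ (2 : ℝ) ^ (1 : ℝ) :=
              Real.rpow_le_rpow_of_exponent_le one_le_two (by linarith)
          _ = 2 := Real.rpow_one 2

/-- `N ≤ 2 · 2^{n/2}`. [folklore] -/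
theorem N_real_le : (g.N : ℝ) ≤ 2 * (2 : ℝ) ^ ((1 / 2 : ℝ) * g.n) := by
  have := g.N_rpow_le (ε := 1) (by norm_num) (by norm_num)
  have hN1 : (g.N : ℝ) ^ (2 - (1 : ℝ)) = g.N := by norm_num
  rw [hN1] at this
  convert this using 3; norm_num

/-- `(N+1)^{2-ε} ≤ 8 · 2^{(1-ε/2) n}` for `0 ≤ ε ≤ 2`. [folklore] -/
theorem N_succ_rpow_le {ε : ℝ} (hε0 : 0 ≤ ε) (hε : ε ≤ 2) :
    ((g.N : ℝ) + 1) ^ (2 - ε) ≤ 8 * (2 : ℝ) ^ ((1 - ε / 2) * g.n) := by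
  have hN1 : (1 : ℝ) ≤ g.N := by exact_mod_cast g.one_le_N
  have hN0 : (0 : ℝ) ≤ g.N := by linarith
  have h2ε : 0 ≤ 2 - ε := by linarith
  calc ((g.N : ℝ) + 1) ^ (2 - ε) ≤ (2 * (g.N : ℝ)) ^ (2 - ε) :=
        Real.rpow_le_rpow (by linarith) (by linarith) h2ε
    _ = (2 : ℝ) ^ (2 - ε) * (g.N : ℝ) ^ (2 - ε) := Real.mul_rpow (by norm_num) hN0
    _ ≤ 4 * (2 * (2 : ℝ) ^ ((1 - ε / 2) * g.n)) := by
        have h4 : (2 : ℝ) ^ (2 - ε) ≤ 4 := by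
          calc (2 : ℝ) ^ (2 - ε) ≤ (2 : ℝ) ^ (2 : ℝ) := Real.rpow_le_rpow_of_exponent_le one_le_two (by linarith)
            _ = 4 := by norm_num
        exact mul_le_mul h4 (g.N_rpow_le hε0 hε) (Real.rpow_nonneg hN0 _) (by norm_num)
    _ = 8 * (2 : ℝ) ^ ((1 - ε / 2) * g.n) := by ring

/-- **The build in real terms**: `Tpre + 4 ≤ K₁ · 2^{δ n}` for `1/2 + η ≤ δ`, given the
polynomial-vs-exponential constant `C₁` of `(n+1)^{k+1} ≤ C₁ 2^{η n}` (no repeated clauses).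
[folklore] -/
theorem build_real_le {k : ℕ} (hw : g.φ.IsWidthLE k) (hnd : g.φ.Nodup) {η δ : ℝ} (hη : 0 ≤ η)
    (hhalf : 1 / 2 + η ≤ δ) {C₁ : ℝ} (hC₁ : ∀ n : ℕ, ((n : ℝ) + 1) ^ (k + 1) ≤ C₁ * (2 : ℝ) ^ (η * n)) :
    (g.Tpre k : ℝ) + 4 ≤
      ((34 * k + 218) * (2 * (((k : ℝ) + 4) * 2 ^ (k + 1) * C₁)) + 4) * (2 : ℝ) ^ (δ * g.n) := by
  set n := g.n with hn
  have hn0 : (0 : ℝ) ≤ n := Nat.cast_nonneg _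
  have hC₁0 : 0 ≤ C₁ := by
    have := hC₁ 0; norm_num at this; linarith
  have hX1 : (1 : ℝ) ≤ (2 : ℝ) ^ (δ * n) := Real.one_le_rpow (by norm_num) (by nlinarith)
  have hexp1 : (2 : ℝ) ^ ((1 / 2 : ℝ) * n) * (2 : ℝ) ^ (η * n) ≤ (2 : ℝ) ^ (δ * n) := by
    rw [← Real.rpow_add (by norm_num)]
    exact Real.rpow_le_rpow_of_exponent_le one_le_two (by nlinarith)
  obtain ⟨hL, -⟩ := g.sizes_le hw hnd
  set M₁ : ℕ := (2 * (g.n + 1)) ^ (k + 1) with hM₁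
  have hM₁R : (M₁ : ℝ) = 2 ^ (k + 1) * ((n : ℝ) + 1) ^ (k + 1) := by
    rw [hM₁]; push_cast; rw [mul_pow]
  have hM₁b : (M₁ : ℝ) ≤ 2 ^ (k + 1) * (C₁ * (2 : ℝ) ^ (η * n)) := by
    rw [hM₁R]; exact mul_le_mul_of_nonneg_left (hC₁ n) (by positivity)
  have hT := g.Tpre_le k
  have cT : (g.Tpre k : ℝ) ≤ (34 * k + 218) * ((g.N : ℝ) * ((g.Lx : ℝ) + n + 1)) := by
    have : ((g.Tpre k : ℕ) : ℝ) ≤ (((34 * k + 218) * (g.N * (g.Lx + g.n + 1)) : ℕ) : ℝ) := by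
      exact_mod_cast hT
    push_cast at this
    linarith
  have cL : (g.Lx : ℝ) + n + 1 ≤ ((k : ℝ) + 4) * M₁ := by
    have : ((g.Lx + g.n + 1 : ℕ) : ℝ) ≤ (((k + 4) * M₁ : ℕ) : ℝ) := by exact_mod_cast hL
    push_cast at this; linarith
  have hA : (g.N : ℝ) * ((g.Lx : ℝ) + n + 1) ≤
      2 * (((k : ℝ) + 4) * 2 ^ (k + 1) * C₁) * (2 : ℝ) ^ (δ * n) := by
    calc (g.N : ℝ) * ((g.Lx : ℝ) + n + 1)
        ≤ (2 * (2 : ℝ) ^ ((1 / 2 : ℝ) * n)) * (((k : ℝ) + 4) * M₁) :=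
          mul_le_mul g.N_real_le cL (by positivity) (by positivity)
      _ ≤ (2 * (2 : ℝ) ^ ((1 / 2 : ℝ) * n)) * (((k : ℝ) + 4) * (2 ^ (k + 1) * (C₁ * (2 : ℝ) ^ (η * n)))) := by
          gcongr
      _ = 2 * (((k : ℝ) + 4) * 2 ^ (k + 1) * C₁) * ((2 : ℝ) ^ ((1 / 2 : ℝ) * n) * (2 : ℝ) ^ (η * n)) := by
          ring
      _ ≤ 2 * (((k : ℝ) + 4) * 2 ^ (k + 1) * C₁) * (2 : ℝ) ^ (δ * n) :=
          mul_le_mul_of_nonneg_left hexp1 (by positivity)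
  have hk0 : (0 : ℝ) ≤ 34 * k + 218 := by positivity
  calc (g.Tpre k : ℝ) + 4 ≤ (34 * k + 218) * ((g.N : ℝ) * ((g.Lx : ℝ) + n + 1)) + 4 := by linarith
    _ ≤ (34 * k + 218) * (2 * (((k : ℝ) + 4) * 2 ^ (k + 1) * C₁) * (2 : ℝ) ^ (δ * n)) +
          4 * (2 : ℝ) ^ (δ * n) := by
        gcongr
        linarith
    _ = _ := by ring

/-- **The emulated run in real terms**: `⌊C (N+1)^{2-ε} (m+2)^c⌋ ≤ K₂ · 2^{δ n}` for
`δ = 1 - ε/2 + η`, given the polynomial-vs-exponential constant `C₂` of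
`(n+1)^{(k+1) c} ≤ C₂ 2^{η n}` (no repeated clauses). [folklore] -/
theorem run_real_le {k : ℕ} (hw : g.φ.IsWidthLE k) (hnd : g.φ.Nodup) {ε η δ : ℝ} (hε0 : 0 ≤ ε)
    (hε : ε ≤ 2) (hη : 0 ≤ η) (hδη : 1 - ε / 2 + η = δ) {c : ℕ} {C₂ : ℝ}
    (hC₂ : ∀ n : ℕ, ((n : ℝ) + 1) ^ ((k + 1) * c) ≤ C₂ * (2 : ℝ) ^ (η * n)) (CM : ℝ) :
    ((⌊CM * (((g.N : ℝ) + 1) ^ (2 - ε) * ((g.m : ℝ) + 2) ^ c)⌋₊ : ℕ) : ℝ) ≤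
      (max CM 0 * (8 * ((3 : ℝ) ^ c * 2 ^ ((k + 1) * c) * C₂)) + max CM 0) * (2 : ℝ) ^ (δ * g.n) := by
  set n := g.n with hn
  set CM' : ℝ := max CM 0 with hCM'
  have hCM'0 : 0 ≤ CM' := le_max_right _ _
  have hn0 : (0 : ℝ) ≤ n := Nat.cast_nonneg _
  have hC₂0 : 0 ≤ C₂ := by
    have := hC₂ 0; norm_num at this; linarith
  have hδ0 : 0 ≤ δ := by nlinarith
  have hX1 : (1 : ℝ) ≤ (2 : ℝ) ^ (δ * n) := Real.one_le_rpow (by norm_num) (by nlinarith)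
  have hexp2 : (2 : ℝ) ^ ((1 - ε / 2) * n) * (2 : ℝ) ^ (η * n) = (2 : ℝ) ^ (δ * n) := by
    rw [← Real.rpow_add (by norm_num), ← hδη]; ring_nf
  obtain ⟨-, hm2⟩ := g.sizes_le hw hnd
  set M₁ : ℕ := (2 * (g.n + 1)) ^ (k + 1) with hM₁
  have hM₁R : (M₁ : ℝ) = 2 ^ (k + 1) * ((n : ℝ) + 1) ^ (k + 1) := by
    rw [hM₁]; push_cast; rw [mul_pow]
  have hM₁c : (M₁ : ℝ) ^ c ≤ 2 ^ ((k + 1) * c) * (C₂ * (2 : ℝ) ^ (η * n)) := by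
    rw [hM₁R, mul_pow, ← pow_mul, ← pow_mul]
    exact mul_le_mul_of_nonneg_left (hC₂ n) (by positivity)
  set Q : ℝ := ((g.N : ℝ) + 1) ^ (2 - ε) * ((g.m : ℝ) + 2) ^ c with hQ
  have hQ0 : 0 ≤ Q := by positivity
  have hN8 := g.N_succ_rpow_le hε0 hε
  have hmc : ((g.m : ℝ) + 2) ^ c ≤ (3 : ℝ) ^ c * 2 ^ ((k + 1) * c) * (C₂ * (2 : ℝ) ^ (η * n)) := by
    have h3 : (g.m : ℝ) + 2 ≤ 3 * M₁ := by
      have : ((g.m + 2 : ℕ) : ℝ) ≤ ((3 * M₁ : ℕ) : ℝ) := by exact_mod_cast hm2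
      push_cast at this; exact this
    calc ((g.m : ℝ) + 2) ^ c ≤ (3 * (M₁ : ℝ)) ^ c := pow_le_pow_left₀ (by positivity) h3 c
      _ = (3 : ℝ) ^ c * (M₁ : ℝ) ^ c := mul_pow _ _ _
      _ ≤ (3 : ℝ) ^ c * (2 ^ ((k + 1) * c) * (C₂ * (2 : ℝ) ^ (η * n))) :=
          mul_le_mul_of_nonneg_left hM₁c (by positivity)
      _ = _ := by ring
  have hQb : Q ≤ 8 * ((3 : ℝ) ^ c * 2 ^ ((k + 1) * c) * C₂) * (2 : ℝ) ^ (δ * n) := by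
    calc Q ≤ (8 * (2 : ℝ) ^ ((1 - ε / 2) * n)) * ((3 : ℝ) ^ c * 2 ^ ((k + 1) * c) * (C₂ * (2 : ℝ) ^ (η * n))) :=
          mul_le_mul hN8 hmc (by positivity) (by positivity)
      _ = 8 * ((3 : ℝ) ^ c * 2 ^ ((k + 1) * c) * C₂) * ((2 : ℝ) ^ ((1 - ε / 2) * n) * (2 : ℝ) ^ (η * n)) := by
          ring
      _ = _ := by rw [hexp2]
  have hfl : ((⌊CM * Q⌋₊ : ℕ) : ℝ) ≤ CM' * Q + CM' := by
    rcases le_or_gt 0 (CM * Q) with h0 | h0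
    · calc ((⌊CM * Q⌋₊ : ℕ) : ℝ) ≤ CM * Q := Nat.floor_le h0
        _ ≤ CM' * Q := mul_le_mul_of_nonneg_right (le_max_left _ _) hQ0
        _ ≤ CM' * Q + CM' := by linarith
    · rw [Nat.floor_of_nonpos h0.le]; push_cast; positivity
  calc ((⌊CM * Q⌋₊ : ℕ) : ℝ) ≤ CM' * Q + CM' := hfl
    _ ≤ CM' * (8 * ((3 : ℝ) ^ c * 2 ^ ((k + 1) * c) * C₂) * (2 : ℝ) ^ (δ * n)) + CM' * (2 : ℝ) ^ (δ * n) := by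
        gcongr
        exact le_mul_of_one_le_right hCM'0 hX1
    _ = _ := by ring

end Params

/-! ### The named fact -/

/-- **Williams' split-and-list reduction on the word RAM, polynomial dimension (proof of the named
fact `kSATInRAMTime_of_ovInTimePolyDim`).** If for some `0 < ε ≤ 1` OV is decided on the
deterministic word RAM within `⌊C ((n+1)^{2-ε} (d+1)^c)⌋₊` steps, then for every width `k` and every
`δ > 1 - ε/2`, `k`-SAT without repeated clauses is decided on the word RAM in time `O(2^{δ n})`:
run the reduction program (`reduction_outputsWithin`) — relocation, header and the `2N` rows of the
OV encoding of the instance `polyOV φ` (`hasOrthogonalPair_polyOV_iff`), one emulated run of the OV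
program, read-out — at word size `kfit · (n + width)`; with `η = δ - (1 - ε/2) > 0`, the build costs
`O_k(N (|x| + n)) = O(2^{n/2} poly(n)) ≤ C 2^{(1/2 + η) n} ≤ C 2^{δ n}` (`|x| ≤ (k+4)(2(n+1))^{k+1}`
as there are no repeated clauses) and the emulated run
`38 ⌊C (N+1)^{2-ε} (m+2)^c⌋ = O(2^{(1-ε/2) n} poly(n)) = O(2^{δ n})` (`N_succ_rpow_le`): no
sparsification is needed. [cite: WilliamsTCS2005, §5.1 (Thm. 5.1; Theorem 5 of the author's version)]
[cite: BringmannKunnemannFOCS2015, Lemma 2.1 (proof)] -/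
theorem _root_.Literature.Computability.FineGrained.kSATInRAMTime_of_ovInTimePolyDim_holds :
    kSATInRAMTime_of_ovInTimePolyDim := by
  classical
  intro ε hε hε1 hOV k δ hδ
  obtain ⟨CM, c, M, kM, hdet, hof, hM⟩ := hOV
  -- the exponents
  set η : ℝ := δ - (1 - ε / 2) with hη
  have hη0 : 0 < η := by linarith
  have hδη : 1 - ε / 2 + η = δ := by rw [hη]; ring
  have hhalf : 1 / 2 + η ≤ δ := by linarith
  obtain ⟨C₁, hC₁0, hC₁⟩ := exists_pow_le_two_rpow (k + 1) hη0
  obtain ⟨C₂, hC₂0, hC₂⟩ := exists_pow_le_two_rpow ((k + 1) * c) hη0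
  -- the program and the constants
  set cM := M.maxConst with hcM
  set CM' : ℝ := max CM 0 with hCM'
  have hCM'0 : 0 ≤ CM' := le_max_right _ _
  set K₁ : ℝ := (34 * k + 218) * (2 * (((k : ℝ) + 4) * 2 ^ (k + 1) * C₁)) + 4 with hK₁
  set K₂ : ℝ := CM' * (8 * ((3 : ℝ) ^ c * 2 ^ ((k + 1) * c) * C₂)) + CM' with hK₂
  have hK₁0 : 0 ≤ K₁ := by positivity
  have hK₂0 : 0 ≤ K₂ := by positivity
  refine ⟨reduction M kM, Params.kfit kM cM, K₁ + 38 * K₂, reduction_isDeterministic M kM,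
    reduction_isOracleFree M kM, fun φ => ?_⟩
  -- one instance
  obtain ⟨hwk, hnd⟩ := φ.2
  set g : Params := ⟨φ.1, kM, cM⟩ with hgdef
  have hsize : (kSATProblem k).size φ = g.n := rfl
  have hwidth : (kSATProblem k).width φ = inputWidth g.x := rfl
  have henc : (kSATProblem k).encode φ = g.x := rfl
  rw [hsize, hwidth, henc]
  have hF := g.fits
  -- the OV program on the instance
  obtain ⟨out, hout, hMrun⟩ := hM (polyOV g.φ)
  rw [OV_good_polyOV, Set.mem_singleton_iff] at hout
  subst hout
  have hws : kM * OV.width (polyOV g.φ) = g.ws := by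
    show kM * inputWidth (OV.encode (polyOV g.φ)) = g.ws
    rw [inputWidth_polyOV]; rfl
  rw [hws] at hMrun
  have hred := g.reduction_outputsWithin hF hwk hdet hof rfl hMrun
  refine ⟨_, (OVRed.kSATProblem_good_iff k φ _).2 rfl, hred.mono ?_⟩
  -- the time bound
  set n := g.n with hn
  apply Nat.le_floor
  have hX0 : (0 : ℝ) < (2 : ℝ) ^ (δ * n) := by positivity
  have hTpre : (g.Tpre k : ℝ) + 4 ≤ K₁ * (2 : ℝ) ^ (δ * n) := g.build_real_le hwk hnd hη0.le hhalf hC₁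
  have hTM : ((⌊CM * ((((polyOV g.φ).n : ℝ) + 1) ^ (2 - ε) * (((polyOV g.φ).d : ℝ) + 1) ^ c)⌋₊ : ℕ) : ℝ) ≤
      K₂ * (2 : ℝ) ^ (δ * n) := by
    have hNn : ((polyOV g.φ).n : ℝ) = g.N := by rw [← g.N_eq]
    have hdd : ((polyOV g.φ).d : ℝ) + 1 = (g.m : ℝ) + 2 := by
      rw [polyOV_d]; push_cast; show (g.m : ℝ) + 1 + 1 = g.m + 2; ring
    rw [hNn, hdd]
    exact g.run_real_le hwk hnd hε.le (by linarith) hη0.le hδη hC₂ CM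
  unfold Params.Ttotal
  push_cast
  have hcs : (cstep : ℝ) = 38 := by norm_num [cstep]
  rw [hcs]
  have hK : 0 ≤ K₁ + 38 * K₂ := by positivity
  have e : (K₁ + 38 * K₂) * (2 : ℝ) ^ (δ * n) = K₁ * (2 : ℝ) ^ (δ * n) + 38 * (K₂ * (2 : ℝ) ^ (δ * n)) := by ring
  rw [e]
  linarith

/-- **SETH ⇒ OVH on the word RAM, discharged** (Bringmann–Künnemann, FOCS 2015, Lemma 2.1: "SETH
implies OVH … For OVH the statement follows from [Williams 2005]"): from the proved split-and-list
reduction `kSATInRAMTime_of_ovInTimePolyDim_holds` by the assembly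
`ovhWordRAM_of_sethWordRAM_of` of `EditDistanceSETH.lean`. [cite: BringmannKunnemannFOCS2015, Lemma 2.1] -/
theorem _root_.Literature.Computability.FineGrained.ovhWordRAM_of_sethWordRAM_holds :
    ovhWordRAM_of_sethWordRAM :=
  ovhWordRAM_of_sethWordRAM_of kSATInRAMTime_of_ovInTimePolyDim_holds

end OVPoly

end Literature.Computability.FineGrained
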